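import Summits.Schanuel.Schanuel.Theorems.ZilberEacParamCurveEdge
import Summits.Schanuel.Schanuel.Theorems.ZilberEacParamCurveSurface
import Literature.ModelTheory.Zilber.EACDensityTransport
import HarnessLib

/-!
# Polynomially parametrised base curves, VI: Zariski density of the exponential points of
# `C × Z(P)`, `C = {(g₀(t), g₁(t))}` a polynomial curve

HONEST FRAMING.  Cell `pub-schanuel` (Zilber's Exponential-Algebraic Closedness, case ladder;
host summit Schanuel), seat 2, gen 19.  We answer Mantova–Masser's "unprojected density"
question (D. Masser, V. Mantova, *Polynomial-exponential equations — some new cases of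
solvability*, PLMS 129 (2024) = arXiv:2303.05592, §1 p. 5; OPEN in general) on a NEW EXPLICIT
FAMILY of surfaces, the first in the cell's node map whose base curve is NOT a graph over a
coordinate axis:

  `S(g; P) = C × Z(P) ⊆ ℂ² × ℂ²`, `C = {(g₀(t), g₁(t)) : t ∈ ℂ}` a polynomially parametrised curve
  (e.g. the cuspidal cubic `x₀³ = x₁²`, the nodal cubic `x₁² = x₀²(x₀ + 1)`), `P ∈ ℂ[y₀, y₁]`
  irreducible.

* `unprojectedDense_paramSurface_of_lt`: `1 ≤ deg g₀ < deg g₁`, `P` with two monomials of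
  different `y₁`-degree ⟹ `I(S ∩ Γ_exp) = I(S)`; `…_of_gt`: the mirror `1 ≤ deg g₁ < deg g₀`, two
  `y₀`-degrees.
* `unprojectedDense_paramSurface_of_eq`: `deg g₀ = deg g₁ ≥ 2` with `lc(g₁)/lc(g₀) ∉ ℝ`, `P` not a
  monomial (any two distinct monomials) ⟹ `I(S ∩ Γ_exp) = I(S)`.
The graph case `g₀ = t` is gen 16's `unprojectedDense_graphCurveSurface`.  What stays OPEN for
polynomial curves: equal degrees with REAL irrational leading ratio (the base is asymptotic to a
real line — cf. the real-line files), rational leading ratio (reduce the degree by a unimodular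
change of coordinates first; not done here), and general (non-polynomial) algebraic base curves
(Puiseux branches at infinity).  This is a modest rung in the case ladder of EAC; it is NOT
Schanuel's conjecture (neither used nor implied; EAC ⇏ SC); `EC(3,2)` stays OPEN.

Proof.  File IV supplies exponential points `(g(t_k), e^{g(t_k)})` of `S` with
`|Re g₀(t_k)| / log(2 + ‖g₀(t_k)‖) → ∞`; file V certifies `S` (irreducible closed surface); the
cell's THEOREM G (`unprojectedDense_of_growth`) concludes.  The mirror statements go through
seat 1's index swap (`EACDensityTransport.unprojectedDense_indexSwapped_iff`).
-/

noncomputable section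

open Filter Topology Metric Set Complex MvPolynomial
open Literature.NumberTheory.Transcendental Literature.ModelTheory.Zilber
open Literature.ModelTheory.ExponentialFields

set_option linter.dupNamespace false

namespace Summit.Schanuel.Schanuel.Theorems

/-! ## Part A. Density from escaping exponential points -/

/-- **Density from escaping exponential points.**  If `S(g; P)` is irreducible closed of dimension
`≤ 2` and there are `t_k` with `P(e^{g₀(t_k)}, e^{g₁(t_k)}) = 0` and
`|Re g₀(t_k)| / log(2 + ‖g₀(t_k)‖) → ∞`, then the exponential points of `S` are Zariski dense
(THEOREM G, `unprojectedDense_of_growth`). (new) -/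
theorem unprojectedDense_paramSurface_of_expPoints (g₀ g₁ : Polynomial ℂ)
    (P : MvPolynomial (Fin 2) ℂ) {t : ℕ → ℂ}
    (ht : ∀ k, MvPolynomial.eval ![exp (g₀.eval (t k)), exp (g₁.eval (t k))] P = 0)
    (hgr : Tendsto (fun k => |(g₀.eval (t k)).re| / Real.log (2 + ‖g₀.eval (t k)‖)) atTop atTop)
    (hS : IsIrreducibleClosed ℂ {w : Fin 2 ⊕ Fin 2 → ℂ | ∃ t : ℂ, w (Sum.inl 0) = g₀.eval t ∧
      w (Sum.inl 1) = g₁.eval t ∧ MvPolynomial.eval (fun i => w (Sum.inr i)) P = 0})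
    (hdim : zariskiDim ℂ {w : Fin 2 ⊕ Fin 2 → ℂ | ∃ t : ℂ, w (Sum.inl 0) = g₀.eval t ∧
      w (Sum.inl 1) = g₁.eval t ∧ MvPolynomial.eval (fun i => w (Sum.inr i)) P = 0} ≤ (2 : ℕ)) :
    UnprojectedDense {w : Fin 2 ⊕ Fin 2 → ℂ | ∃ t : ℂ, w (Sum.inl 0) = g₀.eval t ∧
      w (Sum.inl 1) = g₁.eval t ∧ MvPolynomial.eval (fun i => w (Sum.inr i)) P = 0} := by
  set q : ℕ → Fin 2 ⊕ Fin 2 → ℂ := fun k =>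
    Sum.elim ![g₀.eval (t k), g₁.eval (t k)] ![exp (g₀.eval (t k)), exp (g₁.eval (t k))] with hq
  have hqS : ∀ k, q k ∈ {w : Fin 2 ⊕ Fin 2 → ℂ | ∃ t : ℂ, w (Sum.inl 0) = g₀.eval t ∧
      w (Sum.inl 1) = g₁.eval t ∧ MvPolynomial.eval (fun i => w (Sum.inr i)) P = 0} := by
    intro k
    refine ⟨t k, by simp [hq], by simp [hq], ?_⟩
    have e : (fun i => q k (Sum.inr i)) = ![exp (g₀.eval (t k)), exp (g₁.eval (t k))] := by
      funext i; simp [hq]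
    rw [e]; exact ht k
  have hqΓ : ∀ k, q k ∈ expGraph ℂ 2 := by
    intro k
    rw [mem_expGraph_iff]
    intro i
    rw [Literature.ModelTheory.ExponentialFields.ExponentialRing.complex_exp_eq]
    fin_cases i <;> simp [hq]
  have hgr' : Tendsto (fun k => |(q k (Sum.inl 0)).re| / Real.log (2 + ‖q k (Sum.inl 0)‖))
      atTop atTop := by
    refine hgr.congr fun k => ?_
    simp [hq]
  exact unprojectedDense_of_growth hS hdim 0 hqS hqΓ hgr'

/-! ## Part B. The main theorems -/

/-- **MAIN THEOREM (unequal degrees).**  Let `1 ≤ deg g₀ < deg g₁` and let `P ∈ ℂ[y₀, y₁]` be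
irreducible with two monomials of different `y₁`-degree.  Then the exponential points of
`S(g; P) = {(g₀(t), g₁(t))} × Z(P) ⊆ ℂ² × ℂ²` are Zariski dense: `I(S ∩ Γ_exp) = I(S)`.  An instance
class of Mantova–Masser's open density question over base curves that are not graphs over an
axis (e.g. `g = (t², t³)`, the cusp `x₀³ = x₁²`); NOT Schanuel's conjecture.
[cite: MantovaMasser2023, §1 Further remarks, p. 5 (the question, open in general)] (new) -/
theorem unprojectedDense_paramSurface_of_lt (g₀ g₁ : Polynomial ℂ) (hg₀ : 1 ≤ g₀.natDegree)
    (hlt : g₀.natDegree < g₁.natDegree) {P : MvPolynomial (Fin 2) ℂ} (hirr : Irreducible P)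
    (h2 : ∃ v ∈ P.support, ∃ v' ∈ P.support, v 1 ≠ v' 1) :
    UnprojectedDense {w : Fin 2 ⊕ Fin 2 → ℂ | ∃ t : ℂ, w (Sum.inl 0) = g₀.eval t ∧
      w (Sum.inl 1) = g₁.eval t ∧ MvPolynomial.eval (fun i => w (Sum.inr i)) P = 0} := by
  obtain ⟨t, ht, hgr⟩ := exists_paramCurve_expPoints g₀ g₁ hg₀ P h2
    (paramCurve_dir_of_lt g₀ g₁ hg₀ hlt)
  exact unprojectedDense_paramSurface_of_expPoints g₀ g₁ P ht hgr
    (isIrreducibleClosed_paramSurface g₀ g₁ hg₀ hirr)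
    (by rw [zariskiDim_paramSurface g₀ g₁ hg₀ hirr])

/-- **MAIN THEOREM (equal degrees, non-real leading ratio).**  Let `deg g₀ = deg g₁ ≥ 2` with
`lc(g₁)/lc(g₀) ∉ ℝ` and let `P ∈ ℂ[y₀, y₁]` be irreducible with two monomials of different
`y₁`-degree.  Then the exponential points of `S(g; P)` are Zariski dense.
[cite: MantovaMasser2023, §1 Further remarks, p. 5 (the question, open in general)] (new) -/
theorem unprojectedDense_paramSurface_of_eq (g₀ g₁ : Polynomial ℂ) (hd : 2 ≤ g₀.natDegree)
    (heq : g₁.natDegree = g₀.natDegree)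
    (him : (g₁.leadingCoeff / g₀.leadingCoeff).im ≠ 0) {P : MvPolynomial (Fin 2) ℂ}
    (hirr : Irreducible P) (h2 : ∃ v ∈ P.support, ∃ v' ∈ P.support, v 1 ≠ v' 1) :
    UnprojectedDense {w : Fin 2 ⊕ Fin 2 → ℂ | ∃ t : ℂ, w (Sum.inl 0) = g₀.eval t ∧
      w (Sum.inl 1) = g₁.eval t ∧ MvPolynomial.eval (fun i => w (Sum.inr i)) P = 0} := by
  have hg₀ : 1 ≤ g₀.natDegree := by omega
  obtain ⟨t, ht, hgr⟩ := exists_paramCurve_expPoints g₀ g₁ hg₀ P h2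
    (paramCurve_dir_of_eq g₀ g₁ hd heq him)
  exact unprojectedDense_paramSurface_of_expPoints g₀ g₁ P ht hgr
    (isIrreducibleClosed_paramSurface g₀ g₁ hg₀ hirr)
    (by rw [zariskiDim_paramSurface g₀ g₁ hg₀ hirr])

/-! ## Part C. The mirror statements (index swap) -/

/-- `S(g₀, g₁; P)` is the index swap of `S(g₁, g₀; P^σ)`, `P^σ(y₀, y₁) = P(y₁, y₀)`. -/
theorem paramSurface_eq_indexSwapped (g₀ g₁ : Polynomial ℂ) (P : MvPolynomial (Fin 2) ℂ) :
    {w : Fin 2 ⊕ Fin 2 → ℂ | ∃ t : ℂ, w (Sum.inl 0) = g₀.eval t ∧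
      w (Sum.inl 1) = g₁.eval t ∧ MvPolynomial.eval (fun i => w (Sum.inr i)) P = 0} =
    indexSwapped {w : Fin 2 ⊕ Fin 2 → ℂ | ∃ t : ℂ, w (Sum.inl 0) = g₁.eval t ∧
      w (Sum.inl 1) = g₀.eval t ∧
      MvPolynomial.eval (fun i => w (Sum.inr i)) (rename (Equiv.swap (0 : Fin 2) 1) P) = 0} := by
  ext w
  simp only [Set.mem_setOf_eq, mem_indexSwapped_iff, Function.comp_apply, idxSwap_inl_zero,
    idxSwap_inl_one, eval_rename]
  have e : ((fun i => w (idxSwap (Sum.inr i))) ∘ (Equiv.swap (0 : Fin 2) 1)) =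
      fun i => w (Sum.inr i) := by
    funext i
    fin_cases i <;> simp [idxSwap_inr]
  rw [e]
  constructor
  · rintro ⟨t, h0, h1, hP⟩; exact ⟨t, h1, h0, hP⟩
  · rintro ⟨t, h1, h0, hP⟩; exact ⟨t, h0, h1, hP⟩

/-- `P^σ` is irreducible with `P`. -/
theorem irreducible_rename_swap {P : MvPolynomial (Fin 2) ℂ} (hirr : Irreducible P) :
    Irreducible (rename (Equiv.swap (0 : Fin 2) 1) P) :=
  (MulEquiv.irreducible_iff (renameEquiv ℂ (Equiv.swap (0 : Fin 2) 1)).toMulEquiv).2 hirr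

/-- Two `y₀`-degrees of `P` give two `y₁`-degrees of `P^σ`. -/
theorem exists_support_rename_swap {P : MvPolynomial (Fin 2) ℂ}
    (h2 : ∃ v ∈ P.support, ∃ v' ∈ P.support, v 0 ≠ v' 0) :
    ∃ v ∈ (rename (Equiv.swap (0 : Fin 2) 1) P).support,
      ∃ v' ∈ (rename (Equiv.swap (0 : Fin 2) 1) P).support, v 1 ≠ v' 1 := by
  classical
  obtain ⟨v, hv, v', hv', hne⟩ := h2
  have hinj : Function.Injective (Equiv.swap (0 : Fin 2) 1) := (Equiv.swap (0 : Fin 2) 1).injective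
  refine ⟨Finsupp.mapDomain (Equiv.swap (0 : Fin 2) 1) v, ?_,
    Finsupp.mapDomain (Equiv.swap (0 : Fin 2) 1) v', ?_, ?_⟩
  · rw [support_rename_of_injective hinj]; exact Finset.mem_image_of_mem _ hv
  · rw [support_rename_of_injective hinj]; exact Finset.mem_image_of_mem _ hv'
  · have h1 : Finsupp.mapDomain (Equiv.swap (0 : Fin 2) 1) v 1 = v 0 := by
      have h := Finsupp.mapDomain_apply hinj v 0
      rwa [Equiv.swap_apply_left] at h
    have h1' : Finsupp.mapDomain (Equiv.swap (0 : Fin 2) 1) v' 1 = v' 0 := by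
      have h := Finsupp.mapDomain_apply hinj v' 0
      rwa [Equiv.swap_apply_left] at h
    rw [h1, h1']; exact hne

/-- **MAIN THEOREM, mirror (unequal degrees `1 ≤ deg g₁ < deg g₀`)**: `P` irreducible with two
monomials of different `y₀`-degree ⟹ the exponential points of `S(g; P)` are Zariski dense.
[cite: MantovaMasser2023, §1 Further remarks, p. 5 (the question, open in general)] (new) -/
theorem unprojectedDense_paramSurface_of_gt (g₀ g₁ : Polynomial ℂ) (hg₁ : 1 ≤ g₁.natDegree)
    (hlt : g₁.natDegree < g₀.natDegree) {P : MvPolynomial (Fin 2) ℂ} (hirr : Irreducible P)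
    (h2 : ∃ v ∈ P.support, ∃ v' ∈ P.support, v 0 ≠ v' 0) :
    UnprojectedDense {w : Fin 2 ⊕ Fin 2 → ℂ | ∃ t : ℂ, w (Sum.inl 0) = g₀.eval t ∧
      w (Sum.inl 1) = g₁.eval t ∧ MvPolynomial.eval (fun i => w (Sum.inr i)) P = 0} := by
  rw [paramSurface_eq_indexSwapped, unprojectedDense_indexSwapped_iff]
  exact unprojectedDense_paramSurface_of_lt g₁ g₀ hg₁ hlt (irreducible_rename_swap hirr)
    (exists_support_rename_swap h2)

/-- **MAIN THEOREM (equal degrees), every non-monomial fibre**: `deg g₀ = deg g₁ ≥ 2`,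
`lc(g₁)/lc(g₀) ∉ ℝ`, `P` irreducible with two distinct monomials ⟹ the exponential points of
`S(g; P)` are Zariski dense (two monomials differ in the `y₁`- or in the `y₀`-degree; the latter
case is the mirror of the former, the hypothesis being symmetric).
[cite: MantovaMasser2023, §1 Further remarks, p. 5 (the question, open in general)] (new) -/
theorem unprojectedDense_paramSurface_of_eq_all (g₀ g₁ : Polynomial ℂ) (hd : 2 ≤ g₀.natDegree)
    (heq : g₁.natDegree = g₀.natDegree)
    (him : (g₁.leadingCoeff / g₀.leadingCoeff).im ≠ 0) {P : MvPolynomial (Fin 2) ℂ}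
    (hirr : Irreducible P) (h2 : ∃ v ∈ P.support, ∃ v' ∈ P.support, v ≠ v') :
    UnprojectedDense {w : Fin 2 ⊕ Fin 2 → ℂ | ∃ t : ℂ, w (Sum.inl 0) = g₀.eval t ∧
      w (Sum.inl 1) = g₁.eval t ∧ MvPolynomial.eval (fun i => w (Sum.inr i)) P = 0} := by
  obtain ⟨v, hv, v', hv', hne⟩ := h2
  by_cases h1 : v 1 = v' 1
  · -- then the `y₀`-degrees differ: mirror
    have h0 : v 0 ≠ v' 0 := by
      intro h0
      apply hne
      ext i; fin_cases i
      · exact h0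
      · exact h1
    have him' : (g₀.leadingCoeff / g₁.leadingCoeff).im ≠ 0 := by
      intro h
      apply him
      have hz : g₁.leadingCoeff / g₀.leadingCoeff = (g₀.leadingCoeff / g₁.leadingCoeff)⁻¹ := by
        rw [inv_div]
      rw [hz, Complex.inv_im, h, neg_zero, zero_div]
    rw [paramSurface_eq_indexSwapped, unprojectedDense_indexSwapped_iff]
    exact unprojectedDense_paramSurface_of_eq g₁ g₀ (by omega) heq.symm him'
      (irreducible_rename_swap hirr) (exists_support_rename_swap ⟨v, hv, v', hv', h0⟩)
  · exact unprojectedDense_paramSurface_of_eq g₀ g₁ hd heq him hirr ⟨v, hv, v', hv', h1⟩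

end Summit.Schanuel.Schanuel.Theorems
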